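import Summits.BirchSwinnertonDyer.Rank1Residual.Additive.CongruentPartnerMainConjectureGord
import Summits.BirchSwinnertonDyer.Rank1Residual.Additive.GordRankOneKatoUpperBound
import HarnessLib

/-!
# ONE certificate currency on defect 2: `BranchUnitCertificateAt W p` (this seat, gen 19) ↔
# `BranchUnitCoeffAt W p 1` (n1011-p10) when `L(E,1) = 0`, and ⟹ `BranchCoeffOneNeZeroAt W p`
# (sub-cell additive-p2, gen 20; cell `b2b-bsdres`; bridge requested by n1011-p10, INBOX 2026-08-21T08:18Z)

HONEST FRAMING (cell `b2b-bsdres`, run/shared/lean/b2b/bsd-rank1-residual/, verbatim in every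
file): the goal of the cell is to DELETE the COMBINATION-SHAPED residual classes of the
Birch–Swinnerton-Dyer formula for ALL analytic-rank `≤ 1` elliptic curves over `ℚ` — "full BSD
formula for every rank `≤ 1` curve in class `C`" assembled STRICTLY from published theorems — so
that the rank-`≤ 1` remainder becomes exactly the CONSTRUCTION-SHAPED classes, which are TYPED
(missing-input `Prop`s), NOT attempted. This is not "finishing BSD". Bookkeeping only: no definition,
no named fact, nothing asserted about any curve; labels UNCHANGED, NOTHING booked.

## What

Three typed certificate shapes on the defect-2 rows (the Néron-normalised `ω^{(p−1)/2}`-branch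
`ϖ·B_{(p−1)/2}(f_{E♭}, α♭)` of the twist):
* `BranchUnitCertificateAt W p` (this seat, `GordRankOneKatoCertificate.lean`): constant term `0` AND
  `‖[T¹]‖_p = 1` — `(μ_an, λ_an) = (0, 1)`;
* `BranchUnitCoeffAt W p b` (n1011-p10, `CongruentPartnerMainConjectureGord.lean`): `‖[T^b]‖_p = 1`;
* `BranchCoeffOneNeZeroAt W p` (this seat, `GordRankOneKatoUpperBound.lean`): `[T¹] ≠ 0`.
This file records that they are ONE currency at index `1`: `BranchUnitCertificateAt → BranchUnitCoeffAt W p 1`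
always; conversely when `L(E,1) = 0` (the constant term vanishes by interpolation — Birch / Pal,
`constantCoeff_branch_eq_zero_of_entireLFunction_one_eq_zero`); and `BranchUnitCoeffAt W p 1 →
BranchCoeffOneNeZeroAt W p`. So census-ctyper1's Q6 register at `n₀ = 1`
(`branchUnitCertificateAt_of_gordFirstUnitIndexAt_one`), the X4-2 bit `v_p(A′) = 1`, p10's index-`b`
certificates and this seat's rank-one chains all read the SAME per-pair number.

References: `Additive/GordRankOneKatoCertificate{,Class}.lean`, `GordRankOneKatoUpperBound.lean`
(additive-p2 gen 19); `Additive/CongruentPartnerMainConjectureGord.lean` (n1011-p10);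
[MazurTateTeitelbaum1986Invent] §I.13–I.14; [Pal2012] Thm. 3.2.
-/

noncomputable section

open scoped Classical MatrixGroups ModularForm NumberField

open CongruenceSubgroup WeierstrassCurve NumberField Literature.NumberTheory.EllipticCurves
  Literature.NumberTheory.EllipticCurves.ModularForms
  Literature.NumberTheory.EllipticCurves.Rank1Residual
  IsDedekindDomain

namespace Summit.BirchSwinnertonDyer.Rank1Residual.Additive

variable {W : WeierstrassCurve ℚ} [W.IsElliptic] [W.IsGloballyMinimal] {p : ℕ} [hp : Fact p.Prime]

omit [W.IsElliptic] [W.IsGloballyMinimal] in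
/-- The one-number certificate gives p10's index-`1` certificate (drop the constant-term clause).
[folklore] -/
theorem branchUnitCoeffAt_one_of_branchUnitCertificateAt (h : BranchUnitCertificateAt W p) :
    BranchUnitCoeffAt W p 1 :=
  fun V _ _ C hC hord _ _ f hf ϖ hϖ ↦ (h V C hC hord f hf ϖ hϖ).2

omit [W.IsElliptic] [W.IsGloballyMinimal] in
/-- p10's index-`1` certificate gives the WEAK certificate `[T¹](ϖ·B) ≠ 0` (`‖x‖ = 1 ⟹ x ≠ 0`).
[folklore] -/
theorem branchCoeffOneNeZeroAt_of_branchUnitCoeffAt_one (h : BranchUnitCoeffAt W p 1) :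
    BranchCoeffOneNeZeroAt W p := by
  intro V _ _ C hC hord N _ f hf ϖ hϖ h0
  have h1 := h V C hC hord f hf ϖ hϖ
  rw [h0, norm_zero] at h1
  exact zero_ne_one h1

/-- **When `L(E,1) = 0` the two certificates coincide**: p10's `BranchUnitCoeffAt W p 1` ⟹ this seat's
`BranchUnitCertificateAt W p` (`p ≠ 2`, `E` additive at `p`; Pal's period theorem and modularity for the
vanishing constant term — `branchUnitCertificateAt_of_norm_coeff_one`, whose `hone` binder IS
`BranchUnitCoeffAt W p 1` verbatim). [cite: Pal2012, Thm. 3.2] [cite: MazurTateTeitelbaum1986Invent, §I.13–I.14] -/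
theorem branchUnitCertificateAt_of_branchUnitCoeffAt_one
    (hPal : Pal2012.thm32_sqrt_mul_realPeriodRat_twist_eq_of_prime_one_mod_four)
    (hmod : hasEntireLFunction_rat) (hp2 : p ≠ 2) (hadd : Addv W p) (hL : W.entireLFunction 1 = 0)
    (h : BranchUnitCoeffAt W p 1) : BranchUnitCertificateAt W p :=
  branchUnitCertificateAt_of_norm_coeff_one hPal hmod hp2 hadd hL h

/-- **The equivalence at `L(E,1) = 0`**: `BranchUnitCertificateAt W p ↔ BranchUnitCoeffAt W p 1`.
[cite: Pal2012, Thm. 3.2] [cite: MazurTateTeitelbaum1986Invent, §I.13–I.14] -/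
theorem branchUnitCertificateAt_iff_branchUnitCoeffAt_one
    (hPal : Pal2012.thm32_sqrt_mul_realPeriodRat_twist_eq_of_prime_one_mod_four)
    (hmod : hasEntireLFunction_rat) (hp2 : p ≠ 2) (hadd : Addv W p) (hL : W.entireLFunction 1 = 0) :
    BranchUnitCertificateAt W p ↔ BranchUnitCoeffAt W p 1 :=
  ⟨branchUnitCoeffAt_one_of_branchUnitCertificateAt,
    branchUnitCertificateAt_of_branchUnitCoeffAt_one hPal hmod hp2 hadd hL⟩

/-- **At analytic rank `≥ 1`** (so `L(E,1) = 0` by modularity): the same equivalence with the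
vanishing read off `ord_{s=1} L(E,s) ≠ 0` (`entireLFunction_one_eq_zero_of_analyticRank_ne_zero`).
[cite: Pal2012, Thm. 3.2] -/
theorem branchUnitCertificateAt_iff_branchUnitCoeffAt_one_of_analyticRank_ne_zero
    (hPal : Pal2012.thm32_sqrt_mul_realPeriodRat_twist_eq_of_prime_one_mod_four)
    (hmod : hasEntireLFunction_rat) (hp2 : p ≠ 2) (hadd : Addv W p) (hr : W.analyticRank ≠ 0) :
    BranchUnitCertificateAt W p ↔ BranchUnitCoeffAt W p 1 :=
  branchUnitCertificateAt_iff_branchUnitCoeffAt_one hPal hmod hp2 hadd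
    (entireLFunction_one_eq_zero_of_analyticRank_ne_zero hmod hr)

end Summit.BirchSwinnertonDyer.Rank1Residual.Additive

end
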